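import Summits.QuantumFields.YangMills.Theorems.LuscherReductionTwistedTraceScalingBTHaarFloor
import Summits.QuantumFields.YangMills.Theorems.LuscherReductionTwistedTraceScalingBTWindow
import Summits.QuantumFields.YangMills.Theorems.FemtoTransferGapRungW1up
import HarnessLib

/-!
# The ONE-SITE TOP VALUE is polynomially close to `e^{6B}`: `levelValue su2Rep 1 B 0 ≥ e^{6B}·B^{-9/2}/(2000e³)` for `B ≥ max(1, 2/rStar³)`
# (lane A of S-BASE, crux `TwistedTraceScaling` stmt-QuantumFields-20203, C4-CORE, the (B-T) pen; design note `pub/ym-fleet/ym-luscher-20007-p1/COARSE-DESIGN.md` §25.9 (hτZ))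

The absolute tail `τ` of the (B-T) door `hT_of_fp_add` must satisfy `τ ≤ κ₂·C·λ₀(L³β)`; the tails are `e^{6B}·e^{−c log²β}`, so a POLYNOMIAL floor for `λ₀(B)/e^{6B}` suffices.  From the tree:
`…RungW1up.secondValue_ge` (`(1 − K r)c_B³ ≤ λ₁ ≤ λ₀`, `B r³ = 2`), and `c_B = ∫ e^{B Re tr W} dW ≥ e^{B(2 − ρ²)}·Haar{‖q(W) − 1‖ ≤ ρ} ≥ e^{2B}e^{−Bρ²}ρ³/10` (`…BTHaarFloor.haarReal_quatBall_ge`,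
`Re tr W = 2 − ‖q(W) − 1‖²`), at `ρ = B^{-1/2}`:
* `linkC_ge_exp_mul_haar`, ★ `linkC_ge` (`c_B ≥ e^{2B}·e^{−1}·B^{-3/2}/10` for `B ≥ 1`);
* ★★ `levelValue_one_site_zero_ge` — `e^{6B}·(e^{−3}·B^{−9/2}/2000) ≤ levelValue su2Rep 1 B 0` for `B ≥ max 1 (2/rStar³)`.
HONEST FRAMING: a one-site variational floor (finite-dimensional), for a stub of a child of the CONDITIONAL reduction route R2b1; C4-CORE OPEN; not infinite volume, not a gap, not Clay.
-/

set_option autoImplicit false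

noncomputable section

open MeasureTheory Filter Topology Real
open scoped BigOperators Matrix Quaternion
open Literature.MathematicalPhysics.QuantumFieldTheory
open Literature.MathematicalPhysics.QuantumLattice

namespace Summit.QuantumFields.YangMills.Theorems.FemtoTransferGap.TwoLattice.ConstTube

open Summit.QuantumFields.YangMills.Theorems.FemtoTransferGap
open Summit.QuantumFields.YangMills.Theorems.FemtoTransferGap.TwoLattice

/-! ## §1 The one-link normalisation is within a polynomial of `e^{2B}` -/

/-- `c_B ≥ e^{B(2 − ρ²)}·Haar{‖q(W) − 1‖ ≤ ρ}` (`B ≥ 0`). [folklore] -/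
theorem linkC_ge_exp_mul_haar {B : ℝ} (hB : 0 ≤ B) (ρ : ℝ) : Real.exp (B * (2 - ρ ^ 2)) * (haarProbability SU2).real (quatBall ρ) ≤ linkC B := by
  have hS := measurableSet_quatBall ρ
  have hind : ∫ W, (quatBall ρ).indicator (fun _ => Real.exp (B * (2 - ρ ^ 2))) W ∂haarProbability SU2 = Real.exp (B * (2 - ρ ^ 2)) * (haarProbability SU2).real (quatBall ρ) := by
    rw [integral_indicator_const _ hS, smul_eq_mul, mul_comm]
  rw [← hind]
  unfold linkC
  refine integral_mono ((integrable_const _).indicator hS) (integrable_linkW hB) fun W => ?_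
  by_cases hW : W ∈ quatBall ρ
  · rw [Set.indicator_of_mem hW]
    unfold linkW
    refine Real.exp_le_exp.mpr ?_
    have h := two_sub_re_trace_eq W
    have hq : ‖su2Quat W - 1‖ ^ 2 ≤ ρ ^ 2 := pow_le_pow_left₀ (norm_nonneg _) hW 2
    have hre : ((W : Matrix (Fin 2) (Fin 2) ℂ).trace).re = 2 - ‖su2Quat W - 1‖ ^ 2 := by
      rw [show ((W : Matrix (Fin 2) (Fin 2) ℂ).trace).re = ((su2Rep W).trace).re from rfl]; linarith
    rw [hre]; nlinarith
  · rw [Set.indicator_of_notMem hW]; exact (linkW_pos B W).le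

/-- ★ `c_B ≥ e^{2B}·e^{−1}·B^{−3/2}/10` for `B ≥ 1`. [folklore] -/
theorem linkC_ge {B : ℝ} (hB : 1 ≤ B) : Real.exp (2 * B) * (Real.exp (-1) * (B ^ (-(3 : ℝ) / 2) / 10)) ≤ linkC B := by
  have hB0 : 0 < B := by linarith
  set ρ : ℝ := B ^ (-(1 : ℝ) / 2) with hρ
  have hρpos : 0 < ρ := Real.rpow_pos_of_pos hB0 _
  have hρ1 : ρ ≤ 1 := by
    rw [hρ]; exact Real.rpow_le_one_of_one_le_of_nonpos hB (by norm_num)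
  have hρsq : ρ ^ 2 = B⁻¹ := by
    rw [hρ, ← Real.rpow_natCast, ← Real.rpow_mul hB0.le]; norm_num; rw [Real.rpow_neg_one]
  have hρcube : ρ ^ 3 = B ^ (-(3 : ℝ) / 2) := by
    rw [hρ, ← Real.rpow_natCast, ← Real.rpow_mul hB0.le]; norm_num
  have h1 := linkC_ge_exp_mul_haar hB0.le ρ
  have h2 := haarReal_quatBall_ge hρpos hρ1
  have hexp : Real.exp (B * (2 - ρ ^ 2)) = Real.exp (2 * B) * Real.exp (-1) := by
    rw [← Real.exp_add]; congr 1; rw [hρsq]; field_simp; ring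
  rw [hexp] at h1
  rw [← hρcube]
  calc Real.exp (2 * B) * (Real.exp (-1) * (ρ ^ 3 / 10)) = Real.exp (2 * B) * Real.exp (-1) * (ρ ^ 3 / 10) := by ring
    _ ≤ Real.exp (2 * B) * Real.exp (-1) * (haarProbability SU2).real (quatBall ρ) := mul_le_mul_of_nonneg_left h2 (by positivity)
    _ ≤ linkC B := h1

/-! ## §2 ★★ The polynomial floor for the one-site top value -/

/-- ★★ **`λ₀(B) ≥ e^{6B}·e^{−3}B^{−9/2}/2000`** for `B ≥ max 1 (2/rStar³)` (`rStar` of `…RungW1up`). [cite: ReedSimonIV1978, Thm. XIII.1] [cite: Luscher1983, §3] -/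
theorem levelValue_one_site_zero_ge {B : ℝ} (hB1 : 1 ≤ B) (hB2 : 2 / rStar ^ 3 ≤ B) :
    Real.exp (6 * B) * (Real.exp (-3) * B ^ (-(9 : ℝ) / 2) / 2000) ≤ levelValue su2Rep 1 B 0 := by
  have hrs := rStar_pos
  have hB : 0 < B := by linarith
  have hr := bareLambda_pos' hB
  have hBr := bareLambda_cube hB
  have hrle : bareLambda B ≤ rStar := bareLambda_le_of_le hrs hB2
  have hr1 : bareLambda B ≤ 4 / 5 := hrle.trans (min_le_left _ _)
  have hK := Kcon_pos
  have hKr : Kcon * bareLambda B ≤ 1 / 2 := by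
    calc Kcon * bareLambda B ≤ Kcon * (1 / (2 * Kcon)) := mul_le_mul_of_nonneg_left (hrle.trans (min_le_right _ _)) hK.le
      _ = 1 / 2 := by field_simp
  have h2 := secondValue_ge hB hr hr1 hBr hKr
  have htop : secondValue su2Rep 1 B ≤ levelValue su2Rep 1 B 0 := by
    rw [levelValue_zero]; exact secondValue_le_topValue su2Rep continuous_su2Rep B
  have hc := linkC_ge hB1
  have hc0 : 0 ≤ Real.exp (2 * B) * (Real.exp (-1) * (B ^ (-(3 : ℝ) / 2) / 10)) := by positivity
  have hCE : (Real.exp (2 * B) * (Real.exp (-1) * (B ^ (-(3 : ℝ) / 2) / 10))) ^ 3 ≤ linkCE B := by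
    unfold linkCE; rw [card_edge_one]; exact pow_le_pow_left₀ hc0 hc 3
  have hhalf : (1 : ℝ) / 2 ≤ 1 - Kcon * bareLambda B := by linarith
  have hCE0 : 0 ≤ linkCE B := (linkCE_pos hB.le).le
  have e3 : (Real.exp (2 * B) * (Real.exp (-1) * (B ^ (-(3 : ℝ) / 2) / 10))) ^ 3 = Real.exp (6 * B) * (Real.exp (-3) * (B ^ (-(3 : ℝ) / 2)) ^ 3 / 1000) := by
    have e1 : Real.exp (2 * B) ^ 3 = Real.exp (6 * B) := by rw [← Real.exp_nat_mul]; ring_nf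
    have e2 : Real.exp (-1) ^ 3 = Real.exp (-3) := by rw [← Real.exp_nat_mul]; ring_nf
    rw [mul_pow, mul_pow, div_pow, e1, e2]; ring
  have e4 : (B ^ (-(3 : ℝ) / 2)) ^ 3 = B ^ (-(9 : ℝ) / 2) := by
    rw [← Real.rpow_natCast, ← Real.rpow_mul hB.le]; norm_num
  rw [e3, e4] at hCE
  calc Real.exp (6 * B) * (Real.exp (-3) * B ^ (-(9 : ℝ) / 2) / 2000) = 1 / 2 * (Real.exp (6 * B) * (Real.exp (-3) * B ^ (-(9 : ℝ) / 2) / 1000)) := by ring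
    _ ≤ (1 - Kcon * bareLambda B) * linkCE B := mul_le_mul hhalf hCE (by positivity) (by linarith)
    _ ≤ secondValue su2Rep 1 B := h2
    _ ≤ levelValue su2Rep 1 B 0 := htop

end Summit.QuantumFields.YangMills.Theorems.FemtoTransferGap.TwoLattice.ConstTube

end
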